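import Summits.QuantumAdvantage.QuantumAdvantage.Theorems.WbwObfuscatedGluedTrees.Negative.Altimeter

/-!
# `WbwObfuscatedGluedTrees` (stmt-QuantumAdvantage-2340) — IV: the structured cycle `σ₀ = (id, id)` is broken classically

Support / negative lemmas for the INFORMAL crux `WbwObfuscatedGluedTrees` of route
`Summits/QuantumAdvantage/QuantumAdvantage/Theses/WhiteBoxWalk`, extracted from the refuter work file
`Summits/QuantumAdvantage/QuantumAdvantage/Cruxes/WbwObfuscatedGluedTrees/Disproof.lean` (§1d, cycle 2;
refuter-cdisprove-stmt-QuantumAdvantage-2340-g2-0). Sequel of `Altimeter.lean` (III), whose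
`Altimeter.altimeter`, `Altimeter.adj_cases` and `Squares.OnSquare` /
`Squares.not_onSquare_of_depth_add_two_le` it imports. Sorry-free; no Theses decl is asserted; pure
graph theory on `GluedTrees.graph n σ` (ChildsEtAl2003 §2).

LOAD-BEARING HYPOTHESIS "the alternating cycle is (pseudo)RANDOM". The crux's object joins the
leaves by "a pseudorandom alternating cycle determined by a PRF/PRP key"; ChildsEtAl2003 use a
uniformly random one. What matters is not publicity but STRUCTURE: for the structured datum
`σ₀ = (id, id)` (left leaf `k` — right leaf `k` — left leaf `k+1` — …; a legitimate `G'_n`, on which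
the quantum walk behaves as on any other cycle, the column reduction being `σ`-independent) the
glue edges put every vertex of the bottom two layers on a 4-cycle (`onSquare_σ₀_of_depth_succ_eq`,
`onSquare_σ₀_leafR`, `onSquare_σ₀_leafL`) and — by `Squares.not_onSquare_of_depth_add_two_le`,
valid for every `σ` — no other vertex: `onSquare_σ₀_iff`. The square test costs 4 evaluations of
the neighbour map on canonical names, so it is a recogniser for layer `n - 1` in the sense of
`Altimeter.altimeter`, it orients the walker at the right leaf where it enters the EXIT tree (the
parent is the unique neighbour with a neighbour off the squares) and one level up (the parent is the
unique neighbour off the squares) — all three stated for ANY cycle datum whose glue puts the bottom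
two layers on squares (`altimeter_of_bottom_squares`, `leaf_orientation_of_bottom_squares`,
`orientation_pred_of_bottom_squares`) with the `σ₀` corollaries (`σ₀_altimeter`,
`σ₀_leaf_orientation`, `σ₀_orientation_pred`) — and the climb ends at EXIT
(`iterate_parentV_leafR_eq_exit`). Total: descend `n`, cross
`1`, orient `O(1)`, then `≤ 2(n - 1 - j) + 8` evaluations per level `j = n-2, …, 1` — EXIT with
probability `1` in `≤ n² + 10n + 30` evaluations on EVERY instance with cycle `σ₀`, with or without
obfuscation (simulation for `n ≤ 20`: kit job j010027 on the crux item; e.g. 124 evaluations at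
`n = 13`, while the same walker fails at its first orientation step on random cycles). Hence the PRP
key of the cycle is exactly as sensitive as the naming keys, every hybrid of a would-be proof must
keep the cycle free of short glue cycles near the leaves, and ChildsEtAl2003 Thm 9 visibly needs
its random cycle.
-/

set_option linter.dupNamespace false

namespace Summit.QuantumAdvantage.QuantumAdvantage.Theorems.WbwObfuscatedGluedTrees.Negative

open Literature.Computability.QuantumComplexity

namespace StructuredCycle

open GluedTrees

variable {n : ℕ}

/-- The structured cycle datum `σ₀ = (id, id)`: edges `leafL k — leafR k` and `leafR k — leafL (k+1)`. [folklore] -/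
def σ₀ (n : ℕ) : CycleDatum n := (Equiv.refl _, Equiv.refl _)

/-- First cross neighbour of a right leaf under `σ₀`: the left leaf with the same index. [folklore] -/
theorem crossL_σ₀_fst (k : Fin (2 ^ n)) : (crossL (σ₀ n) k).1 = k := rfl
/-- Second cross neighbour of a right leaf under `σ₀`: the next left leaf. [folklore] -/
theorem crossL_σ₀_snd (k : Fin (2 ^ n)) : (crossL (σ₀ n) k).2 = finRotate _ k := rfl
/-- First cross neighbour of a left leaf under `σ₀`: the right leaf with the same index. [folklore] -/
theorem crossR_σ₀_fst (k : Fin (2 ^ n)) : (crossR (σ₀ n) k).1 = k := rfl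
/-- Second cross neighbour of a left leaf under `σ₀`: the previous right leaf. [folklore] -/
theorem crossR_σ₀_snd (k : Fin (2 ^ n)) : (crossR (σ₀ n) k).2 = (finRotate _).symm k := rfl

/-- `finRotate` on a non-last element, anonymous-constructor form. [folklore] -/
theorem finRotate_mk {M k : ℕ} (h : k + 1 < M) :
    finRotate M ⟨k, (Nat.lt_succ_self k).trans h⟩ = ⟨k + 1, h⟩ := by
  obtain ⟨N, rfl⟩ : ∃ N, M = N + 1 := ⟨M - 1, by omega⟩
  exact finRotate_of_lt (Nat.lt_of_succ_lt_succ h)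

/-- Inverse rotation, anonymous-constructor form. [folklore] -/
theorem finRotate_symm_mk {M k : ℕ} (h : k + 1 < M) :
    (finRotate M).symm ⟨k + 1, h⟩ = ⟨k, (Nat.lt_succ_self k).trans h⟩ := by
  rw [Equiv.symm_apply_eq]
  exact (finRotate_mk h).symm

/-- `2 ^ n` is even for `1 ≤ n` (so an even position `2 i < 2 ^ n` has `2 i + 1 < 2 ^ n`). [folklore] -/
theorem two_pow_even (hn : 1 ≤ n) : ∃ M, 2 ^ n = 2 * M := by
  obtain ⟨m, rfl⟩ : ∃ m, n = m + 1 := ⟨n - 1, by omega⟩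
  exact ⟨2 ^ m, by rw [pow_succ, mul_comm]⟩

/-- A child of a vertex of depth `n - 1` on the right is the right leaf `2 i + b`. [folklore] -/
theorem childV_eq_leafR {v : Vertex n} (hv : depth v + 1 = n) (hs : v.1 = true) (b : Bool) :
    childV v b = leafR n ⟨2 * idx v + b.toNat,
      (two_mul_idx_add_lt v b).trans_eq (by rw [hv])⟩ := by
  rw [Vertex.ext_iff']
  refine ⟨?_, ?_, ?_⟩
  · rw [childV_fst, hs]; rfl
  · rw [depth_childV (by omega), depth_leafR, hv]
  · rw [idx_childV (by omega), idx_leafR]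

/-- A child of a vertex of depth `n - 1` on the left is the left leaf `2 i + b`. [folklore] -/
theorem childV_eq_leafL {v : Vertex n} (hv : depth v + 1 = n) (hs : v.1 = false) (b : Bool) :
    childV v b = leafL n ⟨2 * idx v + b.toNat,
      (two_mul_idx_add_lt v b).trans_eq (by rw [hv])⟩ := by
  rw [Vertex.ext_iff']
  refine ⟨?_, ?_, ?_⟩
  · rw [childV_fst, hs]; rfl
  · rw [depth_childV (by omega), depth_leafL, hv]
  · rw [idx_childV (by omega), idx_leafL]

/-- Adjacency read off the leaf neighbourhoods (right leaf, first cross neighbour). [folklore] -/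
theorem adj_leafR_crossL_fst (hn : 1 ≤ n) (σ : CycleDatum n) (i : Fin (2 ^ n)) :
    (graph n σ).Adj (leafR n i) (leafL n (crossL σ i).1) := by
  rw [← SimpleGraph.mem_neighborFinset, neighborFinset_leafR hn]; simp

/-- Adjacency read off the leaf neighbourhoods (right leaf, second cross neighbour). [folklore] -/
theorem adj_leafR_crossL_snd (hn : 1 ≤ n) (σ : CycleDatum n) (i : Fin (2 ^ n)) :
    (graph n σ).Adj (leafR n i) (leafL n (crossL σ i).2) := by
  rw [← SimpleGraph.mem_neighborFinset, neighborFinset_leafR hn]; simp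

/-- Adjacency read off the leaf neighbourhoods (left leaf, first cross neighbour). [folklore] -/
theorem adj_leafL_crossR_fst (hn : 1 ≤ n) (σ : CycleDatum n) (i : Fin (2 ^ n)) :
    (graph n σ).Adj (leafL n i) (leafR n (crossR σ i).1) := by
  rw [← SimpleGraph.mem_neighborFinset, neighborFinset_leafL hn]; simp

/-- Adjacency read off the leaf neighbourhoods (left leaf, second cross neighbour). [folklore] -/
theorem adj_leafL_crossR_snd (hn : 1 ≤ n) (σ : CycleDatum n) (i : Fin (2 ^ n)) :
    (graph n σ).Adj (leafL n i) (leafR n (crossR σ i).2) := by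
  rw [← SimpleGraph.mem_neighborFinset, neighborFinset_leafL hn]; simp

/-- A non-root vertex is adjacent to its parent (twin of `LoadBearing.lean`'s `Graph.adj_parentV`,
restated to keep this file's import cone inside the Literature graph API). [folklore] -/
theorem adj_parentV (hn : 1 ≤ n) (σ : CycleDatum n) {v : Vertex n} (hv : 1 ≤ depth v) :
    (graph n σ).Adj v (parentV v) := by
  by_cases hvn : depth v < n
  · rw [← SimpleGraph.mem_neighborFinset, neighborFinset_of_depth_lt σ hvn, if_neg (by omega)]
    simp
  · have hv' : depth v = n := le_antisymm (depth_le v) (not_lt.mp hvn)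
    obtain ⟨i, rfl | rfl⟩ := exists_eq_leaf hv'
    · rw [← SimpleGraph.mem_neighborFinset, neighborFinset_leafL hn]; simp
    · rw [← SimpleGraph.mem_neighborFinset, neighborFinset_leafR hn]; simp

/-- Children are neighbours (twin of `LoadBearing.lean`'s `Graph.adj_childV`). [folklore] -/
theorem adj_childV (σ : CycleDatum n) {v : Vertex n} (hv : depth v < n) (b : Bool) :
    (graph n σ).Adj v (childV v b) := by
  rw [← SimpleGraph.mem_neighborFinset, neighborFinset_of_depth_lt σ hv]
  cases b <;> simp

/-- **(a) Layer `n - 1` lies on glue squares under `σ₀`** (both sides): the two leaf children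
`2i`, `2i+1` of `v` have a common cross neighbour (`leafL (2i+1)` on the right, `leafR (2i)` on
the left). [folklore] -/
theorem onSquare_σ₀_of_depth_succ_eq (hn : 1 ≤ n) {v : Vertex n} (hv : depth v + 1 = n) :
    Squares.OnSquare (graph n (σ₀ n)) v := by
  have hvn : depth v < n := by omega
  have hlt1 : 2 * idx v + 1 < 2 ^ n := (two_mul_idx_add_lt v true).trans_eq (by rw [hv])
  have hlt0 : 2 * idx v < 2 ^ n := by omega
  cases hs : v.1
  · -- left: children leafL 2i, leafL (2i+1); common right neighbour leafR 2i
    refine ⟨childV v false, childV v true, leafR n ⟨2 * idx v, hlt0⟩, adj_childV _ hvn _,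
      adj_childV _ hvn _, childV_false_ne_true hvn, ?_, ?_, ?_⟩
    · intro h; have := congrArg Prod.fst h; rw [hs] at this; simp at this
    · rw [childV_eq_leafL hv hs false]
      have := adj_leafL_crossR_fst hn (σ₀ n) ⟨2 * idx v + false.toNat, by simpa using hlt0⟩
      rw [crossR_σ₀_fst] at this
      simpa using this
    · rw [childV_eq_leafL hv hs true]
      have := adj_leafL_crossR_snd hn (σ₀ n) ⟨2 * idx v + true.toNat, by simpa using hlt1⟩
      rw [crossR_σ₀_snd] at this
      simp only [Bool.toNat_true] at this
      rwa [finRotate_symm_mk hlt1] at this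
  · -- right: children leafR 2i, leafR (2i+1); common left neighbour leafL (2i+1)
    refine ⟨childV v false, childV v true, leafL n ⟨2 * idx v + 1, hlt1⟩, adj_childV _ hvn _,
      adj_childV _ hvn _, childV_false_ne_true hvn, ?_, ?_, ?_⟩
    · intro h; have := congrArg Prod.fst h; rw [hs] at this; simp at this
    · rw [childV_eq_leafR hv hs false]
      have := adj_leafR_crossL_snd hn (σ₀ n) ⟨2 * idx v + false.toNat, by simpa using hlt0⟩
      rw [crossL_σ₀_snd] at this
      simp only [Bool.toNat_false, add_zero] at this
      rwa [finRotate_mk hlt1] at this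
    · rw [childV_eq_leafR hv hs true]
      have := adj_leafR_crossL_fst hn (σ₀ n) ⟨2 * idx v + true.toNat, by simpa using hlt1⟩
      rw [crossL_σ₀_fst] at this
      simpa using this

/-- Sibling leaves have the same parent (right). [folklore] -/
theorem parentV_leafR_eq {i j : Fin (2 ^ n)} (h : (i : ℕ) / 2 = (j : ℕ) / 2) :
    parentV (leafR n i) = parentV (leafR n j) := by
  rw [Vertex.ext_iff']
  exact ⟨rfl, rfl, by rw [idx_parentV, idx_parentV, idx_leafR, idx_leafR, h]⟩

/-- Sibling leaves have the same parent (left). [folklore] -/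
theorem parentV_leafL_eq {i j : Fin (2 ^ n)} (h : (i : ℕ) / 2 = (j : ℕ) / 2) :
    parentV (leafL n i) = parentV (leafL n j) := by
  rw [Vertex.ext_iff']
  exact ⟨rfl, rfl, by rw [idx_parentV, idx_parentV, idx_leafL, idx_leafL, h]⟩

/-- **(c) The leaves lie on glue squares under `σ₀`** (right leaves). Even `k = 2i`: the cross
neighbours `leafL 2i`, `leafL (2i+1)` are siblings; odd `k = 2i+1`: the parent and the cross
neighbour `leafL (2i+1)` are both adjacent to the sibling `leafR 2i`. [folklore] -/
theorem onSquare_σ₀_leafR (hn : 1 ≤ n) (k : Fin (2 ^ n)) : Squares.OnSquare (graph n (σ₀ n)) (leafR n k) := by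
  obtain ⟨M, hM⟩ := two_pow_even hn
  obtain ⟨k, hklt⟩ := k
  obtain ⟨i, hk | hk⟩ : ∃ i, k = 2 * i ∨ k = 2 * i + 1 := ⟨k / 2, by omega⟩ <;> subst hk
  · -- even
    have hlt1 : 2 * i + 1 < 2 ^ n := by omega
    refine ⟨leafL n ⟨2 * i, hklt⟩, leafL n ⟨2 * i + 1, hlt1⟩, parentV (leafL n ⟨2 * i, hklt⟩),
      ?_, ?_, ?_, ?_, ?_, ?_⟩
    · exact adj_leafR_crossL_fst hn (σ₀ n) ⟨2 * i, hklt⟩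
    · have := adj_leafR_crossL_snd hn (σ₀ n) ⟨2 * i, hklt⟩
      rw [crossL_σ₀_snd] at this
      rwa [finRotate_mk hlt1] at this
    · intro h; have := congrArg idx h; simp at this
    · intro h; have := congrArg Prod.fst h; simp at this
    · exact adj_parentV hn _ (by simp; omega)
    · rw [parentV_leafL_eq (i := ⟨2 * i, hklt⟩) (j := ⟨2 * i + 1, hlt1⟩)
        (by show 2 * i / 2 = (2 * i + 1) / 2; omega)]
      exact adj_parentV hn _ (by simp; omega)
  · -- odd
    have hlt0 : 2 * i < 2 ^ n := by omega
    refine ⟨parentV (leafR n ⟨2 * i + 1, hklt⟩), leafL n ⟨2 * i + 1, hklt⟩, leafR n ⟨2 * i, hlt0⟩,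
      adj_parentV hn _ (by simp; omega), ?_, ?_, ?_, ?_, ?_⟩
    · exact adj_leafR_crossL_fst hn (σ₀ n) ⟨2 * i + 1, hklt⟩
    · intro h; have := congrArg Prod.fst h; simp at this
    · intro h; have := congrArg idx h; simp at this
    · rw [parentV_leafR_eq (i := ⟨2 * i + 1, hklt⟩) (j := ⟨2 * i, hlt0⟩)
        (by show (2 * i + 1) / 2 = 2 * i / 2; omega)]
      exact (adj_parentV hn _ (by simp; omega)).symm
    · have := adj_leafL_crossR_snd hn (σ₀ n) ⟨2 * i + 1, hklt⟩
      rwa [crossR_σ₀_snd, finRotate_symm_mk hklt] at this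

/-- **(c) The leaves lie on glue squares under `σ₀`** (left leaves). Odd `k = 2i+1`: the cross
neighbours `leafR (2i+1)`, `leafR 2i` are siblings; even `k = 2i`: the parent and the cross
neighbour `leafR 2i` are both adjacent to the sibling `leafL (2i+1)`. [folklore] -/
theorem onSquare_σ₀_leafL (hn : 1 ≤ n) (k : Fin (2 ^ n)) : Squares.OnSquare (graph n (σ₀ n)) (leafL n k) := by
  obtain ⟨M, hM⟩ := two_pow_even hn
  obtain ⟨k, hklt⟩ := k
  obtain ⟨i, hk | hk⟩ : ∃ i, k = 2 * i ∨ k = 2 * i + 1 := ⟨k / 2, by omega⟩ <;> subst hk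
  · -- even
    have hlt1 : 2 * i + 1 < 2 ^ n := by omega
    refine ⟨parentV (leafL n ⟨2 * i, hklt⟩), leafR n ⟨2 * i, hklt⟩, leafL n ⟨2 * i + 1, hlt1⟩,
      adj_parentV hn _ (by simp; omega), ?_, ?_, ?_, ?_, ?_⟩
    · exact adj_leafL_crossR_fst hn (σ₀ n) ⟨2 * i, hklt⟩
    · intro h; have := congrArg Prod.fst h; simp at this
    · intro h; have := congrArg idx h; simp at this
    · rw [parentV_leafL_eq (i := ⟨2 * i, hklt⟩) (j := ⟨2 * i + 1, hlt1⟩)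
        (by show 2 * i / 2 = (2 * i + 1) / 2; omega)]
      exact (adj_parentV hn _ (by simp; omega)).symm
    · have := adj_leafR_crossL_snd hn (σ₀ n) ⟨2 * i, hklt⟩
      rwa [crossL_σ₀_snd, finRotate_mk hlt1] at this
  · -- odd
    have hlt0 : 2 * i < 2 ^ n := by omega
    refine ⟨leafR n ⟨2 * i + 1, hklt⟩, leafR n ⟨2 * i, hlt0⟩, parentV (leafR n ⟨2 * i + 1, hklt⟩),
      ?_, ?_, ?_, ?_, ?_, ?_⟩
    · exact adj_leafL_crossR_fst hn (σ₀ n) ⟨2 * i + 1, hklt⟩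
    · have := adj_leafL_crossR_snd hn (σ₀ n) ⟨2 * i + 1, hklt⟩
      rwa [crossR_σ₀_snd, finRotate_symm_mk hklt] at this
    · intro h; have := congrArg idx h; simp at this
    · intro h; have := congrArg Prod.fst h; simp at this
    · exact adj_parentV hn _ (by simp; omega)
    · rw [parentV_leafR_eq (i := ⟨2 * i + 1, hklt⟩) (j := ⟨2 * i, hlt0⟩)
        (by show (2 * i + 1) / 2 = 2 * i / 2; omega)]
      exact adj_parentV hn _ (by simp; omega)

/-- **Under `σ₀` the glue squares mark exactly the bottom two layers** (`1 ≤ n`). [folklore] -/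
theorem onSquare_σ₀_iff (hn : 1 ≤ n) (v : Vertex n) :
    Squares.OnSquare (graph n (σ₀ n)) v ↔ n ≤ depth v + 1 := by
  constructor
  · intro h
    by_contra hlt
    exact Squares.not_onSquare_of_depth_add_two_le (σ₀ n) (by omega) h
  · intro h
    rcases Nat.lt_or_ge (depth v) n with h2 | h2
    · exact onSquare_σ₀_of_depth_succ_eq hn (by omega)
    · have hv : depth v = n := le_antisymm (depth_le v) h2
      obtain ⟨i, rfl | rfl⟩ := exists_eq_leaf hv
      · exact onSquare_σ₀_leafL hn i
      · exact onSquare_σ₀_leafR hn i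

/-- **Bottom squares are an altimeter, for ANY cycle datum that has them** (§1c with `m = n - 1`,
`R = OnSquare`): if every vertex of depth `n - 1` lies on a square, then at `x` of depth
`1 ≤ j ≤ n - 2` entered from a known child, one non-backtracking walk of `n - 1 - j` edges from `x`
through a candidate `y` ends on a square iff `y` is the other child (the "only if" half needs no
hypothesis on `σ`: `Squares.not_onSquare_of_depth_add_two_le`). [folklore] -/
theorem altimeter_of_bottom_squares (hn : 1 ≤ n) (σ : CycleDatum n)
    (hσ₁ : ∀ v : Vertex n, depth v + 1 = n → Squares.OnSquare (graph n σ) v)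
    {x : Vertex n} (hx : 1 ≤ depth x) (hx₂ : depth x + 2 ≤ n)
    (w : ℕ → Vertex n) (h0 : w 0 = x)
    (hadj : ∀ i, i < n - 1 - depth x → (graph n σ).Adj (w i) (w (i + 1)))
    (hnb : ∀ i, i + 2 ≤ n - 1 - depth x → w (i + 2) ≠ w i) :
    ((∃ b, w 1 = childV x b) → Squares.OnSquare (graph n σ) (w (n - 1 - depth x))) ∧
      (w 1 = parentV x → ¬ Squares.OnSquare (graph n σ) (w (n - 1 - depth x))) :=
  Altimeter.altimeter σ (m := n - 1) (by omega) {v | Squares.OnSquare (graph n σ) v}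
    (fun v hv _ => hσ₁ v (by omega))
    (fun v hv => by
      by_contra h'
      exact Squares.not_onSquare_of_depth_add_two_le σ (v := v) (by omega) hv)
    hx (by omega) w h0 hadj hnb

/-- **Orientation one level above the leaves, for any cycle datum with bottom squares** (`2 ≤ n`):
at `x` of depth `n - 1` the parent is the unique neighbour OFF the squares (the children are
leaves, on squares by hypothesis; the parent has depth `n - 2`). [folklore] -/
theorem orientation_pred_of_bottom_squares (hn : 2 ≤ n) (σ : CycleDatum n)
    (hσ₂ : ∀ v : Vertex n, depth v = n → Squares.OnSquare (graph n σ) v)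
    {x y : Vertex n} (hx : depth x + 1 = n) (hy : (graph n σ).Adj x y) :
    ¬ Squares.OnSquare (graph n σ) y ↔ y = parentV x := by
  rcases Altimeter.adj_cases σ (by omega) hy with ⟨-, rfl⟩ | ⟨b, rfl⟩
  · refine ⟨fun _ => rfl, fun _ => Squares.not_onSquare_of_depth_add_two_le σ ?_⟩
    rw [depth_parentV]; omega
  · constructor
    · intro h; exact absurd (hσ₂ _ (by rw [depth_childV (by omega)]; omega)) h
    · intro h
      have := congrArg depth h
      rw [depth_childV (by omega), depth_parentV] at this
      omega

/-- **Orientation at the entry leaf, for any cycle datum with bottom squares** (`2 ≤ n`): at a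
right leaf the parent is the unique neighbour having a neighbour OFF the squares (its own parent,
depth `n - 2`); the two cross neighbours are left leaves all of whose neighbours (a vertex of depth
`n - 1`, two leaves) are on squares. [folklore] -/
theorem leaf_orientation_of_bottom_squares (hn : 2 ≤ n) (σ : CycleDatum n)
    (hσ₁ : ∀ v : Vertex n, depth v + 1 = n → Squares.OnSquare (graph n σ) v)
    (hσ₂ : ∀ v : Vertex n, depth v = n → Squares.OnSquare (graph n σ) v)
    (k : Fin (2 ^ n)) {y : Vertex n} (hy : (graph n σ).Adj (leafR n k) y) :
    (∃ u, (graph n σ).Adj y u ∧ ¬ Squares.OnSquare (graph n σ) u) ↔ y = parentV (leafR n k) := by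
  have hn1 : 1 ≤ n := by omega
  constructor
  · rintro ⟨u, hyu, hu⟩
    rw [← SimpleGraph.mem_neighborFinset, neighborFinset_leafR hn1] at hy
    simp only [Finset.mem_insert, Finset.mem_singleton] at hy
    rcases hy with rfl | rfl | rfl
    · rfl
    all_goals
      exfalso
      rw [← SimpleGraph.mem_neighborFinset, neighborFinset_leafL hn1] at hyu
      simp only [Finset.mem_insert, Finset.mem_singleton] at hyu
      rcases hyu with rfl | rfl | rfl
      · exact hu (hσ₁ _ (by rw [depth_parentV, depth_leafL]; omega))
      · exact hu (hσ₂ _ (depth_leafR _))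
      · exact hu (hσ₂ _ (depth_leafR _))
  · rintro rfl
    refine ⟨parentV (parentV (leafR n k)), adj_parentV hn1 _ (by simp; omega), ?_⟩
    apply Squares.not_onSquare_of_depth_add_two_le σ
    simp only [depth_parentV, depth_leafR]
    omega

/-- **The squares are an altimeter for `σ₀`** (corollary of `altimeter_of_bottom_squares` and
`onSquare_σ₀_iff`). [folklore] -/
theorem σ₀_altimeter (hn : 1 ≤ n) {x : Vertex n} (hx : 1 ≤ depth x) (hx₂ : depth x + 2 ≤ n)
    (w : ℕ → Vertex n) (h0 : w 0 = x)
    (hadj : ∀ i, i < n - 1 - depth x → (graph n (σ₀ n)).Adj (w i) (w (i + 1)))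
    (hnb : ∀ i, i + 2 ≤ n - 1 - depth x → w (i + 2) ≠ w i) :
    ((∃ b, w 1 = childV x b) → Squares.OnSquare (graph n (σ₀ n)) (w (n - 1 - depth x))) ∧
      (w 1 = parentV x → ¬ Squares.OnSquare (graph n (σ₀ n)) (w (n - 1 - depth x))) :=
  altimeter_of_bottom_squares hn (σ₀ n) (fun v hv => (onSquare_σ₀_iff hn v).2 (by omega))
    hx hx₂ w h0 hadj hnb

/-- **Orientation one level above the leaves** under `σ₀` (`2 ≤ n`). [folklore] -/
theorem σ₀_orientation_pred (hn : 2 ≤ n) {x y : Vertex n} (hx : depth x + 1 = n)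
    (hy : (graph n (σ₀ n)).Adj x y) : ¬ Squares.OnSquare (graph n (σ₀ n)) y ↔ y = parentV x :=
  orientation_pred_of_bottom_squares hn (σ₀ n)
    (fun v hv => (onSquare_σ₀_iff (by omega) v).2 (by omega)) hx hy

/-- **Orientation at the entry leaf** under `σ₀` (`2 ≤ n`). [folklore] -/
theorem σ₀_leaf_orientation (hn : 2 ≤ n) (k : Fin (2 ^ n)) {y : Vertex n}
    (hy : (graph n (σ₀ n)).Adj (leafR n k) y) :
    (∃ u, (graph n (σ₀ n)).Adj y u ∧ ¬ Squares.OnSquare (graph n (σ₀ n)) u) ↔ y = parentV (leafR n k) :=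
  leaf_orientation_of_bottom_squares hn (σ₀ n)
    (fun v hv => (onSquare_σ₀_iff (by omega) v).2 (by omega))
    (fun v hv => (onSquare_σ₀_iff (by omega) v).2 (by omega)) k hy

/-- Climbing keeps the side and reaches depth `0`; on the right, depth `0` is the EXIT
(`n` parent steps from a right leaf). [folklore] -/
theorem iterate_parentV_leafR (k : Fin (2 ^ n)) :
    ∀ j, j ≤ n → ((fun v => parentV v)^[j] (leafR n k)).1 = true ∧
      depth ((fun v => parentV v)^[j] (leafR n k)) = n - j := by
  intro j
  induction j with
  | zero => intro _; simp
  | succ j ih =>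
    intro hj
    obtain ⟨h1, h2⟩ := ih (by omega)
    rw [Function.iterate_succ_apply']
    exact ⟨by rw [parentV_fst, h1], by rw [depth_parentV, h2]; omega⟩

/-- The climb from any right leaf ends at the EXIT after `n` parent steps. [folklore] -/
theorem iterate_parentV_leafR_eq_exit (k : Fin (2 ^ n)) :
    (fun v => parentV v)^[n] (leafR n k) = GluedTrees.exit n := by
  obtain ⟨h1, h2⟩ := iterate_parentV_leafR (n := n) k n le_rfl
  rw [Vertex.ext_iff']
  refine ⟨h1, by rw [h2]; simp, ?_⟩
  have := idx_lt ((fun v => parentV v)^[n] (leafR n k))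
  rw [h2, Nat.sub_self, pow_zero] at this
  show idx _ = 0
  omega

end StructuredCycle

end Summit.QuantumAdvantage.QuantumAdvantage.Theorems.WbwObfuscatedGluedTrees.Negative
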